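import Mathlib
import Summits.Parity.BatemanHorn.Theses.PolynomialMobius
import Summits.Parity.BatemanHorn.Theorems.PolynomialMobiusPolyMobiusTailLargeLocalisation
import Summits.Parity.BatemanHorn.Theorems.PolynomialMobiusPolyMobiusTailLargeBandLowDegree

/-!
# Crux `PolyMobiusTail` (stmt-Parity-0870), skeleton v5 of line `eta-free-multilinear-window`:
# localisation of the CORE `stub_large_core` on systems of total degree `G ≤ 2`

Skeleton v5 (`Cruxes/PolyMobiusTail/Lines/stub_window_linear_le_one.lean`, lead c5) reshapes the cofactor
large part `Large_θ` as `Core_{θ,δ} + Band_{θ,δ}` (cut `∏ eᵢ ≤ x^{1-δ}` versus `> x^{1-δ}`, `δ < θ`), and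
the band is EMPTY for `∑ deg fᵢ ≤ 2` (`stub_large_band_le_two`, p154483).  Combined with the landed
localisation `stub_large_iff_tail_of_window` (p138374: given the window at `(η,θ)`, `Large_θ = o(x)` iff
`Tail_η = o(x)`), this file records the exact strength of the registered stub `stub_large_core` (S4a) on
low-degree systems: for `G ≤ 2`, `0 < η`, `0 ≤ θ`, `δ < θ`, GIVEN the window at `(η, θ)`, the core
conclusion at `(θ, δ)` is EQUIVALENT to the crux's tail conclusion at `η`.  On a linear PAIR the window is
a theorem (p148167), so there S4a ⟺ the `f`-slice of `PolyMobiusTail` ⟺ Λ-Hardy–Littlewood for the pair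
(`Negative.Equivalence.polyMobiusTail_iff_lambdaBatemanHorn`).  Pure bookkeeping; no Bateman–Horn axiom.
-/

open scoped BigOperators
open Filter Finset Polynomial Asymptotics

namespace Summit.Parity.BatemanHorn.Theorems.PolyMobiusTail.EtaFreeWindow

/-- **Range split of the cofactor large part: `Large_θ = Core_{θ,δ} + Band_{θ,δ}`** (pointwise in `x`;
the skeleton's `large_of_core_band` identity with sums written out). [folklore] -/
theorem large_eq_core_add_band {k : ℕ} (f : Fin k → ℤ[X]) (θ δ : ℝ) (x : ℕ) :
    (∑ n ∈ Finset.Icc 1 x, ∑ e ∈ Fintype.piFinset (fun i => (((f i).eval (n : ℤ)).toNat).divisors),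
        if (x : ℝ) ^ (1 + θ) < ∏ i, ((((f i).eval (n : ℤ)).toNat / e i : ℕ) : ℝ) then
          ∏ i, ((ArithmeticFunction.moebius (((f i).eval (n : ℤ)).toNat / e i) : ℝ) *
            Real.log ((((f i).eval (n : ℤ)).toNat / e i : ℕ) : ℝ)) else 0) =
      (∑ n ∈ Finset.Icc 1 x, ∑ e ∈ Fintype.piFinset (fun i => (((f i).eval (n : ℤ)).toNat).divisors),
        if (x : ℝ) ^ (1 + θ) < ∏ i, ((((f i).eval (n : ℤ)).toNat / e i : ℕ) : ℝ) ∧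
            ∏ i, (e i : ℝ) ≤ (x : ℝ) ^ (1 - δ) then
          ∏ i, ((ArithmeticFunction.moebius (((f i).eval (n : ℤ)).toNat / e i) : ℝ) *
            Real.log ((((f i).eval (n : ℤ)).toNat / e i : ℕ) : ℝ)) else 0) +
      ∑ n ∈ Finset.Icc 1 x, ∑ e ∈ Fintype.piFinset (fun i => (((f i).eval (n : ℤ)).toNat).divisors),
        if (x : ℝ) ^ (1 + θ) < ∏ i, ((((f i).eval (n : ℤ)).toNat / e i : ℕ) : ℝ) ∧
            (x : ℝ) ^ (1 - δ) < ∏ i, (e i : ℝ) then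
          ∏ i, ((ArithmeticFunction.moebius (((f i).eval (n : ℤ)).toNat / e i) : ℝ) *
            Real.log ((((f i).eval (n : ℤ)).toNat / e i : ℕ) : ℝ)) else 0 := by
  rw [← Finset.sum_add_distrib]
  refine Finset.sum_congr rfl fun n _ => ?_
  rw [← Finset.sum_add_distrib]
  refine Finset.sum_congr rfl fun e _ => ?_
  by_cases hA : (x : ℝ) ^ (1 + θ) < ∏ i, ((((f i).eval (n : ℤ)).toNat / e i : ℕ) : ℝ)
  · by_cases hle : ∏ i, (e i : ℝ) ≤ (x : ℝ) ^ (1 - δ)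
    · rw [if_pos hA, if_pos ⟨hA, hle⟩, if_neg (fun h => (not_lt.mpr hle) h.2), add_zero]
    · rw [if_pos hA, if_neg (fun h => hle h.2), if_pos ⟨hA, not_le.mp hle⟩, zero_add]
  · rw [if_neg hA, if_neg (fun h => hA h.1), if_neg (fun h => hA h.1), add_zero]

/-- **Aux stub `stub_core_iff_tail_of_window_le_two` — the honest localisation of the CORE on systems of
total degree `≤ 2`.**  For ANY tuple `f : Fin k → ℤ[X]` with `∑ deg fᵢ ≤ 2`, any `0 < η`, `0 ≤ θ`, `δ < θ`:
GIVEN that the window `Σ_{n≤x} Σ_{dᵢ∣fᵢ(n), x^{1-η} < ∏dᵢ ≤ x^{1+θ}} ∏ μ(dᵢ) log dᵢ` is `o(x)`, the conclusion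
of the registered stub `stub_large_core` for `f` at `(θ, δ)` (cofactor large part on COMPLETE pencils
`∏ eᵢ ≤ x^{1-δ}`) is EQUIVALENT to the crux's tail conclusion at `η`
(`Σ_{n≤x} Σ_{dᵢ∣fᵢ(n), x^{1-η} < ∏dᵢ} ∏ μ(dᵢ) log dᵢ = o(x)`).  Reason: `Large_θ = Core + Band` and the band
is eventually `0` for `G ≤ 2` (`stub_large_band_le_two`), then `stub_large_iff_tail_of_window` (p138374).
Hence on every linear pair (window landed, p148167) the core stub is exactly crux-strength — the
Hardy–Littlewood pair asymptotic in cofactor-Möbius form; promoting it does not make it smaller. [folklore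
bookkeeping] -/
theorem stub_core_iff_tail_of_window_le_two : ∀ (k : ℕ) (f : Fin k → ℤ[X]) (η θ δ : ℝ),
    ∑ i, (f i).natDegree ≤ 2 → 0 < η → 0 ≤ θ → δ < θ →
    ((fun x : ℕ => ∑ n ∈ Finset.Icc 1 x,
        ∑ d ∈ Fintype.piFinset (fun i => (((f i).eval (n : ℤ)).toNat).divisors),
          if (x : ℝ) ^ (1 - η) < ∏ i, (d i : ℝ) ∧ ∏ i, (d i : ℝ) ≤ (x : ℝ) ^ (1 + θ) then
            ∏ i, ((ArithmeticFunction.moebius (d i) : ℝ) * Real.log (d i)) else 0)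
      =o[atTop] fun x : ℕ => (x : ℝ)) →
    (((fun x : ℕ => ∑ n ∈ Finset.Icc 1 x,
        ∑ e ∈ Fintype.piFinset (fun i => (((f i).eval (n : ℤ)).toNat).divisors),
          if (x : ℝ) ^ (1 + θ) < ∏ i, ((((f i).eval (n : ℤ)).toNat / e i : ℕ) : ℝ) ∧
              ∏ i, (e i : ℝ) ≤ (x : ℝ) ^ (1 - δ) then
            ∏ i, ((ArithmeticFunction.moebius (((f i).eval (n : ℤ)).toNat / e i) : ℝ) *
              Real.log ((((f i).eval (n : ℤ)).toNat / e i : ℕ) : ℝ)) else 0)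
      =o[atTop] fun x : ℕ => (x : ℝ)) ↔
    ((fun x : ℕ => ∑ n ∈ Finset.Icc 1 x,
        ∑ d ∈ Fintype.piFinset (fun i => (((f i).eval (n : ℤ)).toNat).divisors),
          if (x : ℝ) ^ (1 - η) < ∏ i, (d i : ℝ) then
            ∏ i, ((ArithmeticFunction.moebius (d i) : ℝ) * Real.log (d i)) else 0)
      =o[atTop] fun x : ℕ => (x : ℝ))) := by
  intro k f η θ δ hG hη hθ hδθ hW
  have hBand := stub_large_band_le_two k f hG θ δ hδθ
  have hsplit := fun x : ℕ => large_eq_core_add_band f θ δ x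
  rw [← stub_large_iff_tail_of_window k f η θ hη hθ hW]
  constructor
  · intro hC
    exact (hC.add hBand).congr_left fun x => (hsplit x).symm
  · intro hL
    exact (hL.sub hBand).congr_left fun x => by rw [hsplit x, add_sub_cancel_right]

end Summit.Parity.BatemanHorn.Theorems.PolyMobiusTail.EtaFreeWindow
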